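import Summits.Ventures.DiscreteObjects.Hadamard.GroupCore334Forms
import Summits.Ventures.DiscreteObjects.Hadamard.ConferenceSymmetrization

/-!
# No `C(334)` with a SIGNED automorphism group acting regularly on the core points (kernel)

Framing: lottery ticket; floor = certified bounds/negative ranges.  Cell pub-namedobj (venture DiscreteObjects),
target (H), hadamard gen 28; third file of the `GroupCore334` chapter.  Automorphisms of a conference matrix are
SIGNED permutations (`P C Pᵀ = C`, `P` monomial `±1`), so the census statement 'no `C(334)` has an automorphism group
fixing a point and acting regularly on the other `333`' must allow signs.  For a group of ODD order the signs are a
coboundary and can be removed by a diagonal `±1` conjugation — which keeps the conference property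
(gen 27 `conference_signing`) — reducing to `no_conference334_regularAction` (`GroupCore334Forms`):
* **`signCocycle_coboundary`** — for `±1` sign functions `d_x` (`x ∈ G`, `|G| = 333`) on `Option G` with the cocycle rule
  `d_{yx}(i) = d_y(x·i) d_x(i)` of a signed permutation representation over the action `x·i = Option.map (x * ·) i`,
  the product `e(i) = ∏_x d_x(i)` satisfies `e(x·i) e(i) = d_x(i)` (averaging; uses only that `333` is odd);
* **`no_conference334_signedRegularAction`** — no conference matrix of order `334` on `Option G` (`|G| = 333`) admits
  signed automorphisms `d_x(i) d_x(j) C_{x·i, x·j} = C_{i,j}` for all `x ∈ G` with signs obeying the cocycle rule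
  (i.e. a group of signed permutation automorphisms, fixing the border point, whose permutation part is the regular
  action of `G` on the `333` core points).  With gens 27–28: every such symmetric sub-family of `C(334)` is EMPTY;
  `C(334)` and `H(668)` themselves untouched.  No `sorry`, no new definitions.
-/

namespace Summit.Ventures.DiscreteObjects.Hadamard

open Finset
open scoped Matrix

section signed
variable {G : Type*} [Group G] [Fintype G] [DecidableEq G]

omit [DecidableEq G] in
/-- **Signs of an odd-order signed permutation representation are a coboundary.**  If `d : G → Option G → ℤ` takes
values `±1` and satisfies `d (y * x) i = d y (x·i) * d x i` for the action `x·i = Option.map (x * ·) i`, and `|G| = 333`,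
then `e(i) = ∏_x d x i` has `e (x·i) * e i = d x i`. -/
theorem signCocycle_coboundary (hG : Fintype.card G = 333) (d : G → Option G → ℤ)
    (hd : ∀ x i, d x i = 1 ∨ d x i = -1)
    (hcoc : ∀ x y i, d (y * x) i = d y (Option.map (x * ·) i) * d x i) (x : G) (i : Option G) :
    (∏ y, d y (Option.map (x * ·) i)) * (∏ y, d y i) = d x i := by
  have hsq : ∀ y j, d y j * d y j = 1 := fun y j => by rcases hd y j with h | h <;> rw [h] <;> norm_num
  have h1 : ∀ y, d y (Option.map (x * ·) i) = d (y * x) i * d x i := by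
    intro y; rw [hcoc x y i, mul_assoc, hsq, mul_one]
  rw [Finset.prod_congr rfl fun y _ => h1 y, Finset.prod_mul_distrib, Finset.prod_const, Finset.card_univ, hG,
    Fintype.prod_equiv (Equiv.mulRight x) (fun y => d (y * x) i) (fun y => d y i) (fun _ => rfl)]
  have he : (∏ y, d y i) * (∏ y, d y i) = 1 := by
    rw [← Finset.prod_mul_distrib, Finset.prod_eq_one fun y _ => hsq y i]
  have hpow : d x i ^ 333 = d x i := by rcases hd x i with h | h <;> rw [h] <;> norm_num
  rw [hpow, mul_comm, ← mul_assoc, he, one_mul]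

/-- **No `C(334)` with a group of signed automorphisms acting regularly on the core points.**  For a group `G` of
order `333` and a conference matrix `C` on `Option G` (`0` diagonal, `±1` off it, `C Cᵀ = 333·I`): there are no
signs `d_x(i) = ±1` obeying the cocycle rule with `d_x(i) d_x(j) C_{x·i,x·j} = C_{i,j}` for all `x, i, j`. -/
theorem no_conference334_signedRegularAction (hG : Fintype.card G = 333) (C : Matrix (Option G) (Option G) ℤ)
    (hdiag : ∀ i, C i i = 0) (hoff : ∀ i j, i ≠ j → C i j = 1 ∨ C i j = -1)
    (hC : C * Cᵀ = (333 : ℤ) • (1 : Matrix (Option G) (Option G) ℤ))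
    (d : G → Option G → ℤ) (hd : ∀ x i, d x i = 1 ∨ d x i = -1)
    (hcoc : ∀ x y i, d (y * x) i = d y (Option.map (x * ·) i) * d x i)
    (hinv : ∀ (x : G) (i j : Option G), d x i * d x j * C (Option.map (x * ·) i) (Option.map (x * ·) j) = C i j) :
    False := by
  set e : Option G → ℤ := fun i => ∏ y, d y i with he_def
  have he : ∀ i, e i = 1 ∨ e i = -1 := by
    intro i
    have h2 : e i * e i = 1 := by
      rw [he_def, ← Finset.prod_mul_distrib]
      exact Finset.prod_eq_one fun y _ => by rcases hd y i with h | h <;> rw [h] <;> norm_num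
    have : (e i - 1) * (e i + 1) = 0 := by ring_nf; linarith
    rcases mul_eq_zero.mp this with h | h
    · left; linarith
    · right; linarith
  have hcob : ∀ x i, e (Option.map (x * ·) i) * e i = d x i := fun x i =>
    signCocycle_coboundary hG d hd hcoc x i
  have hcard : ((Fintype.card (Option G) : ℤ) - 1) = 333 := by rw [Fintype.card_option, hG]; norm_num
  have hC' : C * Cᵀ = ((Fintype.card (Option G) : ℤ) - 1) • (1 : Matrix (Option G) (Option G) ℤ) := by
    rw [hcard]; exact hC
  obtain ⟨h1, h2, h3⟩ := conference_signing hdiag hoff hC' he he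
  rw [hcard] at h3
  refine no_conference334_regularAction hG (Matrix.of fun i j => e i * C i j * e j) h1 h2 h3 fun x i j => ?_
  simp only [Matrix.of_apply]
  have hsq : ∀ y j, d y j * d y j = 1 := fun y j => by rcases hd y j with h | h <;> rw [h] <;> norm_num
  have hCx : C (Option.map (x * ·) i) (Option.map (x * ·) j) = d x i * d x j * C i j := by
    have h := hinv x i j
    calc C (Option.map (x * ·) i) (Option.map (x * ·) j)
        = (d x i * d x i) * (d x j * d x j) * C (Option.map (x * ·) i) (Option.map (x * ·) j) := by
          rw [hsq, hsq, one_mul, one_mul]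
      _ = d x i * d x j * (d x i * d x j * C (Option.map (x * ·) i) (Option.map (x * ·) j)) := by ring
      _ = d x i * d x j * C i j := by rw [h]
  have hei : e (Option.map (x * ·) i) = d x i * e i := by
    have hsqe : e i * e i = 1 := by rcases he i with h | h <;> rw [h] <;> norm_num
    calc e (Option.map (x * ·) i) = e (Option.map (x * ·) i) * (e i * e i) := by rw [hsqe, mul_one]
      _ = (e (Option.map (x * ·) i) * e i) * e i := by ring
      _ = d x i * e i := by rw [hcob]
  have hej : e (Option.map (x * ·) j) = d x j * e j := by
    have hsqe : e j * e j = 1 := by rcases he j with h | h <;> rw [h] <;> norm_num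
    calc e (Option.map (x * ·) j) = e (Option.map (x * ·) j) * (e j * e j) := by rw [hsqe, mul_one]
      _ = (e (Option.map (x * ·) j) * e j) * e j := by ring
      _ = d x j * e j := by rw [hcob]
  rw [hCx, hei, hej]
  have h4 : d x i * d x i = 1 := hsq x i
  have h5 : d x j * d x j = 1 := hsq x j
  calc d x i * e i * (d x i * d x j * C i j) * (d x j * e j)
      = (d x i * d x i) * (d x j * d x j) * (e i * C i j * e j) := by ring
    _ = e i * C i j * e j := by rw [h4, h5, one_mul, one_mul]

end signed

end Summit.Ventures.DiscreteObjects.Hadamard
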